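import Summits.QuantumFields.YangMills.Theorems.BalabanUVNodesN19HybridBeyondTarget

/-!
# BalabanUVNodes ∕ node N19 (NE7) — THE RE-KEYING CALCULUS, PART IV (companion): TV-HOMOGENEITY DOES NOT ABSORB.  An explicit two-class ∕ two-point reading in which the
# two runs agree EXACTLY on the young coordinate, differ on the old coordinate by a CLASS-INDEPENDENT factor, run A's conditional old-coordinate laws are TV-close across
# classes at ANY prescribed rate — and yet NO summable `Core` holds at the class key; every LR-factorisation of run A has modulus `≥ ¼·log ε_K⁻¹`

Cell `pub-ymgap` (HUMAN RULING D-0062 Track A ∕ D-0149 width seats), WIDTH SEAT `pub-ymgap-dag-n19-w1` (node n19 = NE7, seat 1 of 3), generation g4, INTENT-1 (second of the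
two files of the CLAIM; split by the 400-line rule).  Route `Summits/QuantumFields/YangMills/Theses/BalabanUVNodes.lean`, key item K3⁷ `SpineGivenEndpointR13SepCoPH`
(stmt-QuantumFields-20544; v5 stub 2 `stub_expansion13H`, conjunct `KeyedCoreEdgeHolderD4` = N19′); filed `--kind proof --supports … --as helper`.  COUNT-NEUTRAL.  THEOREMS ONLY
(0 `def`, 0 `sorry`).  ADDITIVE — imports this seat's g3 `…Theorems.BalabanUVNodesN19HybridBeyondTarget` (p602850: `not_coreEdge_of_unsummable_gap`; through it the tree's
`Spine/NE7/Targets` (`Core`)) ONLY; modifies nothing.  Independent of its sibling `…Theorems.BalabanUVNodesN19RekeyingAbsorption` (either may land first).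

WHY.  The sibling file proves DESCENT WITH ABSORPTION: at a coarser key an ARBITRARY two-run discrepancy on the summed-out (old) coordinate is absorbed into `Core`'s one constant
`c_K`, provided each run factorises as (class factor) × (class-independent old profile) up to a LIKELIHOOD-RATIO error `e^{±s}` — the coarse radius pays `s`, never the discrepancy.
A natural weaker letter would ask only that run A's CONDITIONAL laws of the old coordinate given the class be close in TOTAL VARIATION across classes (the currency of the cell's
TV files).  THIS FILE shows that letter does NOT absorb: for every sequence `0 < ε_K ≤ 1∕4` (summable, super-exponentially small, anything) the explicit reading below has
TV-close conditional laws (modulus `ε_K`), exact young matching, a class-independent old factor — and a class log-ratio gap `≥ log 2 − log(3∕2)` at EVERY level, hence no summable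
`Core` (g3's `not_coreEdge_of_unsummable_gap`).  The LR form is necessary in kind: the toy's LR-factorisation modulus is `≥ ¼·log ε_K⁻¹ → ∞`.
THE TOY at one level (parameter `e = ε_K`; classes `y ∈ Bool`, old coordinate `o ∈ Bool`): run A `p(y, false) = 1`, `p(true, true) = e`, `p(false, true) = e²`; run B `q(y, false) = 1`,
`q(y, true) = ((1 + 2e)∕e)·p(y, true)`.  Fibre sums: `Σ_o p = (e ∣ e²) + 1`, `Σ_o q = (1 + 2e ∣ e(1 + 2e)) + 1`; class ratios `2` and `(e + 2e² + 1)∕(e² + 1) ≤ 3∕2`.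
* §1 [folklore] `tvToyP_fibreSum` · `tvToyQ_fibreSum` (the fibre sums) · `tvToyQ_eq_mul` ((a)+(b): equal on `o = false`, class-independent factor `(1 + 2e)∕e` on `o = true`) ·
  `tvToy_condLaw_close` ((c): run A's two conditional old-coordinate laws `(1, e)∕(1 + e)`, `(1, e²)∕(1 + e²)` differ by `≤ e` pointwise) · ★ `tvToy_lr_lower` ((d): any positive
  `m(y)·φ(o)` within `e^{±s}` of run A's four weights has `log e⁻¹ ≤ 4s`) · `tvToy_gap` (the class gap `≥ log 2 − log(3∕2)` for `0 < e ≤ 1∕4`).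
* §2 [folklore] ★★ `not_coreEdge_tvToy` ((e): along any `0 < ε_K ≤ 1∕4`, any `l₀ ≥ 0`, any `vol`, NO `δ` with `Core l₀ vol (K ↦ {false,true}) ∅ (Σ_o p) (Σ_o q) δ ∧ Summable δ`).
READING (located, nothing proposed): the decoupling letter (D) of the window-key road («run A's old-structure profile is homogeneous across window classes») must be stated in
likelihood-ratio ∕ max-divergence form per block; a TV-form (D) — however fast its modulus decays in `K` — leaves an extensive old discrepancy unabsorbed.

HONEST FRAMING.  One explicit finite toy + elementary real arithmetic [folklore] over the tree's SHAPE `Core`; nothing of Bałaban's is asserted or instantiated; no estimate of the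
programme is proved.  NE7 NOT PRINTED as a two-run statement for d = 4 ∕ NOT proved; N19 NOT discharged; K3⁷ OPEN, not claimed; counts UNMOVED (typed 28∕28 · discharged 5∕27,
A 5∕28).  Everything below is PROVED (0 `sorry`, 0 named facts, standard axioms); no decl carries a cite tag.  One finite four-torus programme at fixed ε — NOT ℝ⁴, NOT infinite
volume, NOT OS, NOT a mass gap, NOT the Clay problem (R4 closes the conditional finite-𝕋⁴ rung `BalabanLadder.UV` only).
-/

noncomputable section

open Finset
open scoped BigOperators

namespace Summit.QuantumFields.YangMills.BalabanUVNodes.N19RekeyingAbsorptionTVSharp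

open Summit.QuantumFields.BalabanUV.T4Continuum.Spine.NE7 (Core)
open Summit.QuantumFields.YangMills.BalabanUVNodes.N19HybridBeyondTarget (not_coreEdge_of_unsummable_gap)

/-! ## §1 The toy and its four properties [folklore] -/


/-- THE TOY, RUN A at one level (classes `y ∈ Bool`, summed-out coordinate `o ∈ Bool`, parameter `e = ε_K`): weight `1` on `o = false` in both classes; on `o = true` weight `e` in
class `true` and `e²` in class `false`.  Its fibre sum over the summed-out coordinate is `(if y then e else e²) + 1`. [folklore] -/
theorem tvToyP_fibreSum (e : ℝ) (y : Bool) :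
    ∑ o ∈ (Finset.univ : Finset Bool), (if o then (if y then e else e ^ 2) else (1 : ℝ)) = (if y then e else e ^ 2) + 1 := by
  simp only [Fintype.sum_bool, if_true, Bool.false_eq_true, if_false]

/-- THE TOY, RUN B: equal to run A on `o = false`; on `o = true` run A's weight times the CLASS-INDEPENDENT factor `M = (1 + 2e)∕e`, i.e. `1 + 2e` in class `true` and `e(1 + 2e)` in
class `false`.  Fibre sum `(if y then 1 + 2e else e(1 + 2e)) + 1`. [folklore] -/
theorem tvToyQ_fibreSum (e : ℝ) (y : Bool) :
    ∑ o ∈ (Finset.univ : Finset Bool), (if o then (if y then 1 + 2 * e else e * (1 + 2 * e)) else (1 : ℝ)) =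
      (if y then 1 + 2 * e else e * (1 + 2 * e)) + 1 := by
  simp only [Fintype.sum_bool, if_true, Bool.false_eq_true, if_false]

/-- (a)+(b) THE WHOLE DISCREPANCY IS A CLASS-INDEPENDENT FIBRE FACTOR: on `o = false` the runs agree, on `o = true` run B is run A times `M = (1 + 2e)∕e` in BOTH classes (`e ≠ 0`) — so
in the sibling file's §3 language `φ_B = M·φ_A`, which would be absorbed IF run A factorised; young structure (`o = false`) is matched EXACTLY. [folklore] -/
theorem tvToyQ_eq_mul {e : ℝ} (he : e ≠ 0) (y o : Bool) :
    (if o then (if y then 1 + 2 * e else e * (1 + 2 * e)) else (1 : ℝ)) = (if o then (1 + 2 * e) / e else 1) * (if o then (if y then e else e ^ 2) else (1 : ℝ)) := by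
  cases o
  · simp only [Bool.false_eq_true, if_false, one_mul]
  · cases y
    · simp only [if_true, Bool.false_eq_true, if_false]
      rw [div_mul_eq_mul_div, sq, ← mul_assoc, mul_div_cancel_right₀ _ he, mul_comm]
    · simp only [if_true]
      rw [div_mul_eq_mul_div, mul_div_cancel_right₀ _ he]

/-- (c) RUN A's CONDITIONAL FIBRE LAWS ARE TV-CLOSE: the two classes' conditional laws of the summed-out coordinate, `o ↦ p(y,o) ∕ Σ_o p(y,o)` = `(1, e)∕(1 + e)` and `(1, e²)∕(1 + e²)`,
differ by at most `e` at every point (`0 < e`) — so along `e = ε_K ↓ 0` as small as desired, as fast as desired. [folklore] -/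
theorem tvToy_condLaw_close {e : ℝ} (he : 0 < e) (o : Bool) :
    |(if o then e else (1 : ℝ)) / (e + 1) - (if o then e ^ 2 else (1 : ℝ)) / (e ^ 2 + 1)| ≤ e := by
  have h1 : 0 < e + 1 := by linarith
  have h2 : 0 < e ^ 2 + 1 := by positivity
  cases o
  · simp only [Bool.false_eq_true, if_false]
    rw [div_sub_div _ _ h1.ne' h2.ne', abs_div, abs_of_pos (mul_pos h1 h2), div_le_iff₀ (mul_pos h1 h2), abs_le]
    constructor <;> nlinarith [sq_nonneg e, mul_pos he he]
  · simp only [if_true]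
    rw [div_sub_div _ _ h1.ne' h2.ne', abs_div, abs_of_pos (mul_pos h1 h2), div_le_iff₀ (mul_pos h1 h2), abs_le]
    constructor <;> nlinarith [sq_nonneg e, mul_pos he he, pow_pos he 3]

/-- **(d) … BUT NO SMALL LR-FACTORISATION**: if run A's four toy weights `p(true,true) = e`, `p(false,true) = e²`, `p(true,false) = p(false,false) = 1` lie within `e^{±s}` of ANY product
`m(y)·φ(o)` of positive class factors and a positive profile (the sibling file's hypothesis `hfacA` at one level — only one side of each sandwich is used), then `log e⁻¹ ≤ 4s`:
the LR modulus of every factorisation of the toy is `≥ ¼·log ε_K⁻¹ → ∞`.  (The class ratio on `o = true` is `e⁻¹`, on `o = false` it is `1`; a factorisation pins both to `m(true)∕m(false)` up to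
`e^{±2s}`.) [folklore] -/
theorem tvToy_lr_lower {e s : ℝ} (he : 0 < e) {m φ : Bool → ℝ} (hm : ∀ y, 0 < m y) (hφ : ∀ o, 0 < φ o)
    (h₁ : e ≤ Real.exp s * (m true * φ true)) (h₂ : Real.exp (-s) * (m false * φ true) ≤ e ^ 2)
    (h₃ : Real.exp (-s) * (m true * φ false) ≤ 1) (h₄ : 1 ≤ Real.exp s * (m false * φ false)) :
    Real.log e⁻¹ ≤ 4 * s := by
  have hY : m false * φ true ≤ Real.exp s * e ^ 2 := by
    have := mul_le_mul_of_nonneg_left h₂ (Real.exp_pos s).le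
    rwa [← mul_assoc, ← Real.exp_add, add_neg_cancel, Real.exp_zero, one_mul] at this
  have hZ : m true * φ false ≤ Real.exp s * 1 := by
    have := mul_le_mul_of_nonneg_left h₃ (Real.exp_pos s).le
    rwa [← mul_assoc, ← Real.exp_add, add_neg_cancel, Real.exp_zero, one_mul] at this
  have hXW : e * 1 ≤ Real.exp s * (m true * φ true) * (Real.exp s * (m false * φ false)) :=
    mul_le_mul h₁ h₄ zero_le_one (mul_nonneg (Real.exp_pos s).le (mul_nonneg (hm true).le (hφ true).le))
  have hYZ : m false * φ true * (m true * φ false) ≤ Real.exp s * e ^ 2 * (Real.exp s * 1) :=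
    mul_le_mul hY hZ (mul_nonneg (hm true).le (hφ false).le) (mul_nonneg (Real.exp_pos s).le (pow_pos he 2).le)
  have key : e ≤ Real.exp (4 * s) * e ^ 2 := by
    have e4 : Real.exp (4 * s) = Real.exp s * Real.exp s * (Real.exp s * Real.exp s) := by
      simp only [← Real.exp_add]; congr 1; ring
    calc e = e * 1 := (mul_one e).symm
      _ ≤ Real.exp s * (m true * φ true) * (Real.exp s * (m false * φ false)) := hXW
      _ = Real.exp s * Real.exp s * (m false * φ true * (m true * φ false)) := by ring
      _ ≤ Real.exp s * Real.exp s * (Real.exp s * e ^ 2 * (Real.exp s * 1)) := mul_le_mul_of_nonneg_left hYZ (by positivity)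
      _ = Real.exp (4 * s) * e ^ 2 := by rw [e4]; ring
  have hlog := Real.log_le_log he key
  rw [Real.log_mul (Real.exp_pos _).ne' (pow_pos he 2).ne', Real.log_exp, Real.log_pow] at hlog
  rw [Real.log_inv]
  push_cast at hlog
  linarith

/-- The class gap of the toy's fibre sums: `(log Σq − log Σp)(true) − (log Σq − log Σp)(false) ≥ log 2 − log(3∕2)` whenever `0 < e ≤ 1∕4` (class `true` has ratio exactly `2`,
class `false` has ratio `(e + 2e² + 1)∕(e² + 1) ≤ 3∕2`). [folklore] -/
theorem tvToy_gap {e : ℝ} (he : 0 < e) (he4 : e ≤ 1 / 4) :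
    Real.log 2 - Real.log (3 / 2) ≤
      (Real.log (1 + 2 * e + 1) - Real.log (e + 1)) - (Real.log (e * (1 + 2 * e) + 1) - Real.log (e ^ 2 + 1)) := by
  have h1 : 0 < e + 1 := by linarith
  have h2 : 0 < e ^ 2 + 1 := by positivity
  have htrue : Real.log (1 + 2 * e + 1) - Real.log (e + 1) = Real.log 2 := by
    rw [← Real.log_div (by linarith) h1.ne']
    congr 1
    field_simp
    ring
  have hfalse : Real.log (e * (1 + 2 * e) + 1) - Real.log (e ^ 2 + 1) ≤ Real.log (3 / 2) := by
    rw [← Real.log_div (by positivity) h2.ne']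
    apply Real.log_le_log (div_pos (by positivity) h2)
    rw [div_le_iff₀ h2]
    nlinarith
  linarith

/-! ## §2 No summable `Core` at the class key [folklore] -/

/-- **★★ (e) NO SUMMABLE `Core` AT THE CLASS KEY FOR THE TOY** [folklore].  With `0 < ε_K ≤ 1∕4` (ANY such sequence — summable, super-exponentially small, …), any `l₀ ≥ 0`, any `vol`:
the toy's fibre sums over the summed-out coordinate (run A `(if y then ε_K else ε_K²) + 1`, run B `(if y then 1 + 2ε_K else ε_K(1 + 2ε_K)) + 1`, written as the sums of
`tvToyP_fibreSum` ∕ `tvToyQ_fibreSum`) admit NO `δ` with `Core l₀ vol (K ↦ {false, true}) ∅ (Σ_o p) (Σ_o q) δ ∧ Summable δ` — the class gap is `≥ log(4∕3)` at every level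
(g3's `not_coreEdge_of_unsummable_gap` BY NAME).  With (a)–(d): exact young matching + a class-independent old factor + TV-decoupling of run A's conditional old-structure laws at
ANY rate do NOT give `Core` at the coarse key; the LIKELIHOOD-RATIO form of the sibling file's homogeneity letter (§3∕§4 there) is necessary in kind. -/
theorem not_coreEdge_tvToy {ε : ℕ → ℝ} {l₀ vol : ℝ} (hl₀ : 0 ≤ l₀) (hε : ∀ K, 0 < ε K) (hε4 : ∀ K, ε K ≤ 1 / 4) :
    ¬ ∃ δ : ℕ → ℝ, Core l₀ vol (fun _ => (Finset.univ : Finset Bool)) (fun _ _ => (∅ : Finset Bool))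
        (fun K _ y => ∑ o ∈ (Finset.univ : Finset Bool), (if o then (if y then ε K else ε K ^ 2) else (1 : ℝ)))
        (fun K _ y => ∑ o ∈ (Finset.univ : Finset Bool), (if o then (if y then 1 + 2 * ε K else ε K * (1 + 2 * ε K)) else (1 : ℝ))) δ ∧
      Summable δ := by
  have hgpos : 0 < Real.log 2 - Real.log (3 / 2) := by
    rw [sub_pos]
    exact Real.log_lt_log (by norm_num) (by norm_num)
  refine not_coreEdge_of_unsummable_gap (g := fun _ => Real.log 2 - Real.log (3 / 2)) (fun _ => hgpos.le) ?_ ?_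
  · intro hs
    exact hgpos.ne' (tendsto_nhds_unique tendsto_const_nhds hs.tendsto_atTop_zero)
  · intro K
    refine ⟨0, by simpa using hl₀, true, by simp, false, by simp, ?_, ?_, ?_⟩
    · simp only [Fintype.sum_bool, if_true, Bool.false_eq_true, if_false]
      linarith [hε K]
    · simp only [Fintype.sum_bool, if_true, Bool.false_eq_true, if_false]
      positivity
    · simp only [Fintype.sum_bool, if_true, Bool.false_eq_true, if_false]
      exact tvToy_gap (hε K) (hε4 K)


end Summit.QuantumFields.YangMills.BalabanUVNodes.N19RekeyingAbsorptionTVSharp
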